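import Summits.BirchSwinnertonDyer.BirchSwinnertonDyer.Theorems.ByReductionTypeAtTwoOrdKatoHalfAtTwoIsoSignFreeDefs
import Summits.BirchSwinnertonDyer.BirchSwinnertonDyer.Theses.ByReductionTypeAtTwo
import HarnessLib

/-!
# Crux `OrdKatoHalfAtTwoIso` (stmt-BirchSwinnertonDyer-19573), line `steinberg-fibre-at-two` — P7 RESTATE CERTIFICATE, PART B
# (lead g5, pen RC-366): the two proposed SIGN-FREE child texts are `Iff.rfl` the Theorems constants of
# `…OrdKatoHalfAtTwoIsoSignFreeDefs.lean`, the proposed texts imply / are implied by the filed ones as stated, and the split glue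
# `OrdKatoHalfAtTwoIsoOfChildren` closes BY NAME after the P7 restates (and after the F1 restate alone)

Nothing asserted; `sorry`-free. Texts: T_F1μ⁺ (F1 slot, child 23890 `OrdKatoFineZetaAtTwoResidue` ↦; sha16 of the one-line text file
48ddb3e9fb8486ba) = the rev-33 text with `W.Δ < 0 →` deleted; T_core⁺ (B8 slot, child 23762 `OrdKatoIntSurjectiveAtTwo` ↦; sha16
b5a5102f49862cab) = the body of `SteinbergFibreAtTwo.CoreTheoremATwoResidue` with `0 < W.Δ`. Part A (`…_restate_P7_header.lean`) shows both
texts elaborate with ONLY the route file imported (no new route import). ORDER for the operator: F1 slot first (or both at once) —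
«F1μ (Δ<0), core⁺» has no door. BSD is not proved; the crux and its children stay OPEN.
-/

set_option linter.dupNamespace false

namespace Summit.BirchSwinnertonDyer.BirchSwinnertonDyer.Cruxes.OrdKatoHalfAtTwoIso.SteinbergFibreAtTwo.RestateP7

open Summit.BirchSwinnertonDyer.BirchSwinnertonDyer.Theses.ByReductionTypeAtTwo
open Summit.BirchSwinnertonDyer.BirchSwinnertonDyer.Theorems

/-- PROPOSED TEXT T_F1μ⁺ for the F1 slot (child 23890 ↦ sign-free; route vocabulary, fully qualified, doubly unfolded). [folklore] -/
def OrdKatoFineZetaAtTwoSignFreeText : Prop :=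
  ∀ (W : WeierstrassCurve ℚ) [W.IsElliptic] [W.IsGloballyMinimal] [ContinuousSMul (PadicInt 2) (W.tateModule 2)] [Module.Free (PadicInt 2) (W.tateModule 2)] [Module.Finite (PadicInt 2) (W.tateModule 2)] {N : ℕ} [NeZero N] (f : CuspForm (Subgroup.map (Matrix.SpecialLinearGroup.mapGL ℝ) (CongruenceSubgroup.Gamma0 N)) 2) (κ : Literature.NumberTheory.EllipticCurves.ZpExtension ℚ 2) (γ : Field.absoluteGaloisGroup ℚ) (hκ : κ.IsCyclotomic), Literature.NumberTheory.EllipticCurves.IsOrdinaryAt W 2 → W.HasSurjectiveModNGaloisRep 2 → κ.IsTopGenerator γ → Literature.NumberTheory.EllipticCurves.IsCyclotomicVariable 2 γ → Literature.NumberTheory.EllipticCurves.ModularForms.IsNewformOf W f → ∀ (D : W.SelmerDualData κ γ) (Y : W.FineSelmerDualData κ γ), ∃ (I : Literature.NumberTheory.EllipticCurves.Kato2004.IwasawaH1Data W 2 κ γ) (Z : Submodule (Literature.NumberTheory.EllipticCurves.IwasawaAlgebra 2) I.H) (P : Submodule (Literature.NumberTheory.EllipticCurves.IwasawaAlgebra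 2) (Literature.NumberTheory.EllipticCurves.IwasawaAlgebra 2)) (ℓ : I.H →ₗ[Literature.NumberTheory.EllipticCurves.IwasawaAlgebra 2] P) (τ : P →ₗ[Literature.NumberTheory.EllipticCurves.IwasawaAlgebra 2] D.X) (π : D.X →ₗ[Literature.NumberTheory.EllipticCurves.IwasawaAlgebra 2] Y.X), Z ≤ Submodule.span (Literature.NumberTheory.EllipticCurves.IwasawaAlgebra 2) {s : I.H | Literature.NumberTheory.EllipticCurves.Kato2004.IsEulerSystemClassTwo W hκ I s} ∧ (∀ z ∈ Z, τ (ℓ z) = 0) ∧ Function.Surjective π ∧ Function.Exact τ π ∧ ∀ G₁ : Literature.NumberTheory.EllipticCurves.IwasawaAlgebra 2, Literature.NumberTheory.EllipticCurves.iwasawaToPowerSeries 2 G₁ = Literature.NumberTheory.EllipticCurves.padicLFunction f (Literature.NumberTheory.EllipticCurves.unitRoot W 2 : ℚ_[2]) → ∃ s : Literature.NumberTheory.EllipticCurves.IwasawaAlgebra 2, s ∉ Literature.NumberTheory.EllipticCurves.IwasawaAlgebra.augIdealP 2 ∧ s * G₁ ∈ Submodule.map (P.subtype ∘ₗ ℓ)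 Z

/-- PROPOSED TEXT T_core⁺ for the B8 slot (child 23762 ↦ the core Theorem A at `2` on `0 < Δ`; route vocabulary, fully qualified). [folklore] -/
def OrdKatoCoreRealPlaceAtTwoText : Prop :=
  ∀ (W : WeierstrassCurve ℚ) [W.IsElliptic] [W.IsGloballyMinimal] [ContinuousSMul (PadicInt 2) (W.tateModule 2)] [Module.Free (PadicInt 2) (W.tateModule 2)] [Module.Finite (PadicInt 2) (W.tateModule 2)] (κ : Literature.NumberTheory.EllipticCurves.ZpExtension ℚ 2) (γ : Field.absoluteGaloisGroup ℚ) (I : Literature.NumberTheory.EllipticCurves.Kato2004.IwasawaH1Data W 2 κ γ) (hκ : κ.IsCyclotomic), W.HasGoodReductionAtPrime 2 → ¬ (2 : ℤ) ∣ W.frobeniusTrace 2 → W.HasSurjectiveModNGaloisRep 2 → 0 < W.Δ → κ.IsTopGenerator γ → (∃ s : I.H, Literature.NumberTheory.EllipticCurves.Kato2004.IsEulerSystemClassTwo W hκ I s ∧ s ∉ Literature.NumberTheory.EllipticCurves.IwasawaAlgebra.augIdealP 2 • (⊤ : Submodule (Literature.NumberTheory.EllipticCurves.IwasawaAlgebra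 2) I.H)) → ∃ J : ℕ, ∀ y : Literature.NumberTheory.EllipticCurves.subgroupH1 κ.kerSubgroup (WeierstrassCurve.geomTorsion W (2 : ℤ)), W.torsionToPrimaryH1Sub 2 κ.kerSubgroup y ∈ W.fineSelmerInfty κ → (⇑(Literature.NumberTheory.EllipticCurves.conjH1 κ.kerSubgroup (WeierstrassCurve.geomTorsion W (2 : ℤ)) γ - AddMonoidHom.id (Literature.NumberTheory.EllipticCurves.subgroupH1 κ.kerSubgroup (WeierstrassCurve.geomTorsion W (2 : ℤ)))))^[J] y = 0

/-- (1a) T_F1μ⁺ is VERBATIM (`Iff.rfl`) the Theorems constant `SteinbergFibreAtTwo.ZetaColemanMuInputsAtTwo`. [folklore] -/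
theorem f1muPlus_text_iff :
    OrdKatoFineZetaAtTwoSignFreeText ↔ SteinbergFibreAtTwo.ZetaColemanMuInputsAtTwo :=
  Iff.rfl

/-- (1b) T_core⁺ is VERBATIM (`Iff.rfl`) the Theorems constant `SteinbergFibreAtTwo.CoreTheoremAPosDiscTwo`. [folklore] -/
theorem corePosDisc_text_iff :
    OrdKatoCoreRealPlaceAtTwoText ↔ SteinbergFibreAtTwo.CoreTheoremAPosDiscTwo :=
  Iff.rfl

/-- (2a) The proposed F1 text implies the filed one (child 23890, rev 33: habitat `Δ < 0`). [folklore] -/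
theorem f1muPlus_implies_filed (h : OrdKatoFineZetaAtTwoSignFreeText) : OrdKatoFineZetaAtTwoResidue :=
  SteinbergFibreAtTwo.zetaColemanMuInputsNegDiscAtTwo_of_zetaColemanMuInputsAtTwo h

/-- (2b) The two proposed texts (+ Abbes–Ullmo + Kato 17.4 (1)(2) read off the PUB conjunct of the bundle) imply the FILED B8 text
(child 23762 = `KatoIntAtGoodOrdSurjectiveTwo` by name): B8 is DERIVED after P7. [folklore] -/
theorem texts_imply_filed_B8 (hB : OrdKatoIsoPrintBundleAtTwo) (hF1 : OrdKatoFineZetaAtTwoSignFreeText)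
    (hcore : OrdKatoCoreRealPlaceAtTwoText) : OrdKatoIntSurjectiveAtTwo := by
  obtain ⟨hPub, hAU, -⟩ := hB
  obtain ⟨_, _, h17, _⟩ := hPub
  exact SteinbergFibreAtTwo.katoIntAtGoodOrdSurjectiveTwo_of_signFree hF1 hcore hAU h17

/-- (3a) AFTER BOTH P7 restates (bundle = child 23889 as filed; F1 slot := T_F1μ⁺; B7 slot := B7′ as filed at rev 36, i.e. the constant
`KatoMuPartOff514AtOptimalMemberOfNotSurjectiveTwo`; B8 slot := T_core⁺) the split glue closes BY NAME. [folklore] -/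
theorem glue_after_P7 :
    OrdKatoIsoPrintBundleAtTwo → OrdKatoFineZetaAtTwoSignFreeText →
      SteinbergFibreAtTwo.KatoMuPartOff514AtOptimalMemberOfNotSurjectiveTwo → OrdKatoCoreRealPlaceAtTwoText →
        OrdKatoHalfAtTwoIso :=
  fun hB hF1 hB7 hB8 => SteinbergFibreAtTwo.ordKatoHalfAtTwoIso_of_signFree_cite hF1 hB8 hB hB7

/-- (3b) AFTER THE F1 RESTATE ONLY (B8 slot still the filed `KatoIntAtGoodOrdSurjectiveTwo`) the split glue closes BY NAME through the
rev-36 door `ordKatoHalfAtTwoIso_of_recut_cite` and monotonicity F1μ⁺ ⇒ F1μ. [folklore] -/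
theorem glue_after_F1_only :
    OrdKatoIsoPrintBundleAtTwo → OrdKatoFineZetaAtTwoSignFreeText →
      SteinbergFibreAtTwo.KatoMuPartOff514AtOptimalMemberOfNotSurjectiveTwo → OrdKatoIntSurjectiveAtTwo →
        OrdKatoHalfAtTwoIso :=
  fun hB hF1 hB7 hB8 => SteinbergFibreAtTwo.ordKatoHalfAtTwoIso_of_recut_cite
    (SteinbergFibreAtTwo.zetaColemanMuInputsNegDiscAtTwo_of_zetaColemanMuInputsAtTwo hF1) hB.2.1 hB.2.2 hB7 hB8 hB.1

end Summit.BirchSwinnertonDyer.BirchSwinnertonDyer.Cruxes.OrdKatoHalfAtTwoIso.SteinbergFibreAtTwo.RestateP7
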